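import Mathlib.NumberTheory.Padics.Complex
import Mathlib.Topology.Instances.Matrix
import Mathlib.Topology.Algebra.MvPolynomial
import Mathlib.LinearAlgebra.Matrix.Charpoly.Univ
import Mathlib.Analysis.Normed.Group.Ultra
import Mathlib.Algebra.Order.Archimedean.Basic
import Mathlib.Algebra.MvPolynomial.CommRing
import Mathlib.Algebra.MvPolynomial.Variables
import Summits.Langlands.Langlands.Theorems.PhantomRMYoshidaResiduallyYoshidaLiftingCrossRegularDefs
import Literature.NumberTheory.GaloisRepresentations.FrobeniusDensity
import Literature.NumberTheory.Automorphic.ChebotarevArtinRepHolds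
import Literature.NumberTheory.GaloisRepresentations.CompactImageCharpolyIntegral
import HarnessLib

/-!
# The limit `N → ∞` at fixed level (Hecke-span congruences force automorphy)

Stub `stub_limitAtFixedLevel` (S5b) of line `cross-regular-annihilator-primes` for the crux
`Summit.Langlands.Langlands.Theses.PhantomRMYoshida.ResiduallyYoshidaLifting` (stmt-Langlands-13639),
over the landed currency `Theorems/PhantomRMYoshidaResiduallyYoshidaLiftingCrossRegularDefs.lean`
(`Sh`, `Member`, `HSC`, `Aut` of namespace
`Summit.Langlands.Langlands.Cruxes.ResiduallyYoshidaLifting.CrossRegularAnnihilatorPrimes`).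

Let `p` be a prime and `ρ : Γ_ℚ → GL₄(ℚ̄_p)` continuous of the crux's shape `Sh` (in particular
unramified almost everywhere).  Fix a level `𝔫₁` and an infinity type `T₁`, and suppose:

* (CATALOGUE) finitely many members `(πc j, rc j)`, `j < s`, of the Hecke family of level `K(𝔫₁)` and
  type `T₁` (`Member`) such that EVERY member `(π, r)` of that family has the same characteristic
  polynomials as some `rc j`, pointwise on `Γ_ℚ`;
* (FAMILIES) for every `N`, finitely many members `(πf i, ρf i)` of the same family to which `ρ` is
  Hecke-span congruent modulo `p^N` (`HSC N`): away from a finite set `S` of places, every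
  `ℤ̄_p`-polynomial relation among the coefficients of the integral Frobenius polynomials of the `ρf i`
  holds for those of `ρ` modulo `p^N`.

Then `ρ` is automorphic (`Aut`): some `πc j` matches `ρ` at almost all places.

Proof (the last step, "`N → ∞`", of Khare–Thorne style successive approximation; Thorne 2016,
Cor. 4.15).  If `det(X - ρ(g)) = det(X - rc j (g))` for all `g` and some `j`, the matching clause of
`Member` for `(πc j, rc j)` transfers verbatim to `ρ` (Frobenius polynomials are values of `det(X - ·)`),
and `ρ` is unramified almost everywhere by `Sh`.  Otherwise pick, for each `j`, an element `g_j` and an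
index `d_j` with `δ_j := c_{d_j}(ρ(g_j)) - c_{d_j}(rc j (g_j)) ≠ 0` (`c_d` = `d`-th coefficient of the
characteristic polynomial), and `N` with `‖p‖^N < ∏_j ‖δ_j‖`.  Take the family and the finite set `S` at
depth `N`.  The coefficients `c_d` are continuous on `Γ_ℚ` (polynomials in the matrix entries, Mathlib
`Matrix.charpoly.univ`) and arithmetic Frobenii at places outside `S` are dense
(`absoluteGaloisGroup.frobenius_dense`, from the proved Chebotarev theorem `chebotarev_artinRep_holds`),
so there are Frobenii `φ_j` at places `v_j ∉ S` with `‖κ_j(φ_j) - δ_j‖ < ‖δ_j‖`, whence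
`‖κ_j(φ_j)‖ = ‖δ_j‖` (ultrametric), where `κ_j(g) := c_{d_j}(ρ(g)) - c_{d_j}(rc j (g))`.  With `Pc_j` the
integral model of `det(X - rc j (φ_j))` (`FramedGaloisRep.exists_charpoly_eq_map`), the polynomial
`F := ∏_j (X_{(v_j, d_j)} - (Pc_j)_{d_j})` has variables at places outside `S` and vanishes at every
member `(πf i, ρf i)` (its Frobenius polynomial at `v_{j(i)}` IS `Pc_{j(i)}` for the catalogue index
`j(i)` of the member, both being integral models of `det(X - ρf i (φ_{j(i)})) = det(X - rc_{j(i)}(φ_{j(i)}))`).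
Hence `p^N` divides `F` evaluated at the Frobenius coefficients of `ρ`, which is `∏_j x_j` with
`x_j ∈ ℤ̄_p`, `x_j = κ_j(φ_j)` in `ℚ̄_p`; taking norms, `∏_j ‖δ_j‖ ≤ ‖p‖^N`, a contradiction.

## References

* J. Thorne, *Automorphy of some residually dihedral Galois representations*, Math. Ann. 364
  (2016), Thm. 4.14, Cor. 4.15. [Thorne2016]
* J.-P. Serre, *Abelian ℓ-adic representations and elliptic curves* (1968), Ch. I §2.2 Cor. 2 (a)
  (Frobenii are dense), §2.3 (a semisimple representation is determined by its Frobenius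
  polynomials). [SerreAbelianLadic1968]
-/

noncomputable section

-- `Summit.Langlands.Langlands.…` (summit = sub-problem name, D-0017 layout) trips `dupNamespace` on every decl.
set_option linter.dupNamespace false

open Field IsDedekindDomain Filter Topology Polynomial
open scoped NumberField Valued

namespace Summit.Langlands.Langlands.Cruxes.ResiduallyYoshidaLifting.CrossRegularAnnihilatorPrimes

open Literature.NumberTheory.GaloisRepresentations

section Helpers

variable {p : ℕ} [Fact p.Prime]

/-- `0 < ‖p‖ < 1` in `ℚ̄_p`. [folklore] -/
private theorem norm_p_pos_lt_one : 0 < ‖(p : PadicAlgCl p)‖ ∧ ‖(p : PadicAlgCl p)‖ < 1 := by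
  -- adapted from `Theorems/PhantomRMYoshidaResiduallyYoshidaLiftingCrossRegularSupply.lean`
  have hp : (1 : ℝ) < p := by exact_mod_cast (Fact.out : p.Prime).one_lt
  rw [← map_natCast (algebraMap ℚ_[p] (PadicAlgCl p)) p, norm_algebraMap', Padic.norm_p]
  exact ⟨inv_pos.2 (zero_lt_one.trans hp), inv_lt_one_of_one_lt₀ hp⟩

/-- Elements of the valuation ring `ℤ̄_p = 𝒪[ℚ̄_p]` have norm `≤ 1` (`Valued.v x = ‖x‖₊`). [folklore] -/
private theorem norm_subtype_le_one (t : 𝒪[PadicAlgCl p]) :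
    ‖(𝒪[PadicAlgCl p]).subtype t‖ ≤ 1 := by
  have h : Valued.v (t : PadicAlgCl p) ≤ 1 := t.2
  rw [PadicAlgCl.valuation_def] at h
  exact_mod_cast h

/-- In an ultrametric normed group, `‖a - b‖ < ‖b‖` forces `‖a‖ = ‖b‖` (all triangles are
isosceles). [folklore] -/
private theorem norm_eq_of_norm_sub_lt {E : Type*} [SeminormedAddCommGroup E] [IsUltrametricDist E]
    {a b : E} (h : ‖a - b‖ < ‖b‖) : ‖a‖ = ‖b‖ := by
  have h1 := IsUltrametricDist.norm_add_eq_max_of_norm_ne_norm (ne_of_lt h)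
  rwa [sub_add_cancel, max_eq_right h.le] at h1

/-- The coefficients of the characteristic polynomial depend continuously on the matrix (they are
polynomials in the entries: Mathlib `Matrix.charpoly.univ`). [folklore] -/
private theorem continuous_charpoly_coeff {X A : Type*} [TopologicalSpace X] [CommRing A]
    [TopologicalSpace A] [IsTopologicalRing A] {n : Type*} [Fintype n] [DecidableEq n]
    {f : X → Matrix n n A} (hf : Continuous f) (i : ℕ) :
    Continuous fun x => (f x).charpoly.coeff i := by
  -- adapted from `Theorems/PhantomRMYoshidaResiduallyYoshidaLiftingCrossRegularSupply.lean`
  have h : (fun x => (f x).charpoly.coeff i) = fun x =>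
      MvPolynomial.eval (fun ij : n × n => f x ij.1 ij.2) ((Matrix.charpoly.univ A n).coeff i) := by
    funext x
    exact (Matrix.charpoly.univ_coeff_eval₂Hom n (RingHom.id A) (fun ij : n × n => f x ij.1 ij.2) i).symm
  rw [h]
  exact (MvPolynomial.continuous_eval _).comp (continuous_pi fun ij => hf.matrix_elem ij.1 ij.2)

end Helpers

/-- **Stub S5b (the limit `N → ∞` at fixed level).**  Let `ρ : Γ_ℚ → GL₄(ℚ̄_p)` be continuous of the
crux's shape `Sh`.  Suppose the members of the Hecke family of level `K(𝔫₁)` and infinity type `T₁` fall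
into finitely many pointwise characteristic-polynomial classes, represented by a finite CATALOGUE of
members `(πc j, rc j)`, and that for every `N` the representation `ρ` is Hecke-span congruent modulo
`p^N` (`HSC N`) to finitely many members of that family.  Then `ρ` is automorphic (`Aut`).  Proof: if
`det(X - ρ(·)) = det(X - rc j (·))` for some `j`, the matching clause of `Member (πc j) (rc j)` transfers
to `ρ` (unramified a.e. by `Sh`).  Otherwise choose `g_j`, `d_j` with
`δ_j := c_{d_j}(ρ(g_j)) - c_{d_j}(rc j (g_j)) ≠ 0` and `N` with `‖p‖^N < ∏_j ‖δ_j‖`; by continuity of the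
coefficients `c_d` of `det(X - ·)` (Mathlib `Matrix.charpoly.univ`) and density of Frobenii outside the
finite exceptional set `S` of `HSC N` (`absoluteGaloisGroup.frobenius_dense chebotarev_artinRep_holds`)
there are Frobenii `φ_j` at `v_j ∉ S` with `‖c_{d_j}(ρ(φ_j)) - c_{d_j}(rc j (φ_j))‖ = ‖δ_j‖`
(ultrametric); the polynomial `F := ∏_j (X_{(v_j,d_j)} - (Pc_j)_{d_j})`, `Pc_j` the integral model of
`det(X - rc j (φ_j))` (`FramedGaloisRep.exists_charpoly_eq_map`), has admissible support and vanishes at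
every member (whose Frobenius polynomial at `v_{j(i)}` is `Pc_{j(i)}` for its catalogue index `j(i)`), so
`p^N ∣ F(ρ) = ∏_j x_j` in `ℤ̄_p` with `‖x_j‖ = ‖δ_j‖`, i.e. `∏_j ‖δ_j‖ ≤ ‖p‖^N`, a contradiction.
[cite: Thorne2016, Thm. 4.14 and Cor. 4.15 (f(T_v) = tr ρ(Frob_v) mod λ^N for all N forces automorphy)] -/
theorem stub_limitAtFixedLevel : ∀ (p : ℕ) [Fact p.Prime], p ≠ 2 → ∀ (k : Type) [Field k] [CharP k p] [IsAlgClosed k] [TopologicalSpace k] [DiscreteTopology k] (red : Valued.integer (PadicAlgCl p) →+* k) (σ σ' : Literature.NumberTheory.GaloisRepresentations.FramedGaloisRep ℚ k 2) (hcpt : Literature.NumberTheory.Automorphic.isCompact_glFiniteIntegralLevel 4 ℚ) (ι : PadicAlgCl p ≃+* ℂ) (ρ : Literature.NumberTheory.GaloisRepresentations.FramedGaloisRep ℚ (PadicAlgCl p) 4), Summit.Langlands.Langlands.Cruxes.ResiduallyYoshidaLifting.CrossRegularAnnihilatorPrimes.Sh σ σ' red ρ → ∀ (𝔫₁ : Ideal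 (NumberField.RingOfIntegers ℚ)) (T₁ : Literature.NumberTheory.Automorphic.InfinityType ℚ 4), (∃ (s : ℕ) (πc : Fin s → Literature.NumberTheory.Automorphic.CuspidalAutomorphicRepData 4 ℚ hcpt) (rc : Fin s → Literature.NumberTheory.GaloisRepresentations.FramedGaloisRep ℚ (PadicAlgCl p) 4), (∀ j, Summit.Langlands.Langlands.Cruxes.ResiduallyYoshidaLifting.CrossRegularAnnihilatorPrimes.Member σ σ' red ι 𝔫₁ T₁ (πc j) (rc j)) ∧ ∀ (π : Literature.NumberTheory.Automorphic.CuspidalAutomorphicRepData 4 ℚ hcpt) (r : Literature.NumberTheory.GaloisRepresentations.FramedGaloisRep ℚ (PadicAlgCl p) 4), Summit.Langlands.Langlands.Cruxes.ResiduallyYoshidaLifting.CrossRegularAnnihilatorPrimes.Member σ σ' red ι 𝔫₁ T₁ π r → ∃ j, ∀ g, (r g).val.charpoly = (rc j g).val.charpoly) → (∀ N : ℕ, ∃ (r : ℕ) (πf : Fin r → Literature.NumberTheory.Automorphic.CuspidalAutomorphicRepData 4 ℚ hcpt) (ρf : Fin r → Literature.NumberTheory.GaloisRepresentations.FramedGaloisRep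 ℚ (PadicAlgCl p) 4), (∀ i, Summit.Langlands.Langlands.Cruxes.ResiduallyYoshidaLifting.CrossRegularAnnihilatorPrimes.Member σ σ' red ι 𝔫₁ T₁ (πf i) (ρf i)) ∧ Summit.Langlands.Langlands.Cruxes.ResiduallyYoshidaLifting.CrossRegularAnnihilatorPrimes.HSC N r ρf ρ) → Summit.Langlands.Langlands.Cruxes.ResiduallyYoshidaLifting.CrossRegularAnnihilatorPrimes.Aut hcpt ι ρ := by
  intro p _ _ k _ _ _ _ _ red σ σ' hcpt ι ρ hρ 𝔫₁ T₁ hcatE hfam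
  obtain ⟨s, πc, rc, hcatM, hcat⟩ := hcatE
  by_cases hA : ∃ j, ∀ g, (ρ g).val.charpoly = (rc j g).val.charpoly
  · -- CASE A: `ρ` has the characteristic polynomials of a catalogue member; its `π` works.
    obtain ⟨j, hj⟩ := hA
    obtain ⟨hLalg, -, -, -, -, hmatch⟩ := hcatM j
    obtain ⟨-, -, hρae⟩ := hρ
    refine ⟨πc j, hLalg, ?_⟩
    filter_upwards [hmatch, hρae] with v hv hv'
    obtain ⟨a, ha, -, hfrob⟩ := hv
    refine ⟨a, ha, hv'.1, fun 𝔓 h𝔓 τ hτ => ?_⟩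
    exact (hj τ).trans (hfrob 𝔓 h𝔓 τ hτ)
  · -- CASE B: every catalogue member differs from `ρ` somewhere; contradiction for large `N`.
    exfalso
    push Not at hA
    choose g hg using hA
    -- an index at which the characteristic polynomials at `g j` differ
    have hexd : ∀ j, ∃ d : ℕ,
        ((ρ (g j)).val.charpoly).coeff d - ((rc j (g j)).val.charpoly).coeff d ≠ 0 := by
      intro j
      by_contra h
      push Not at h
      exact hg j (Polynomial.ext fun n => sub_eq_zero.1 (h n))
    choose d hd using hexd
    obtain ⟨κ, hκ⟩ : ∃ κ : Fin s → absoluteGaloisGroup ℚ → PadicAlgCl p,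
        ∀ j x, κ j x = ((ρ x).val.charpoly).coeff (d j) - ((rc j x).val.charpoly).coeff (d j) :=
      ⟨_, fun _ _ => rfl⟩
    have hκc : ∀ j, Continuous (κ j) := by
      intro j
      have h : κ j = fun x =>
          ((ρ x).val.charpoly).coeff (d j) - ((rc j x).val.charpoly).coeff (d j) := funext (hκ j)
      rw [h]
      exact (continuous_charpoly_coeff (Units.continuous_val.comp (map_continuous ρ)) (d j)).sub
        (continuous_charpoly_coeff (Units.continuous_val.comp (map_continuous (rc j))) (d j))
    have hδ : ∀ j, 0 < ‖κ j (g j)‖ := fun j => norm_pos_iff.2 (by rw [hκ]; exact hd j)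
    -- the depth `N`: `‖p‖ ^ N < ∏ j, ‖δ j‖`
    have hp01 := norm_p_pos_lt_one (p := p)
    have hc : 0 < ∏ j, ‖κ j (g j)‖ := Finset.prod_pos fun j _ => hδ j
    obtain ⟨N, hN⟩ := exists_pow_lt_of_lt_one hc hp01.2
    -- the family at depth `N` and its exceptional set `S`
    obtain ⟨r, πf, ρf, hmem, S, hS, Pf, Pr, hPf, hPr, hHSC⟩ := hfam N
    -- Frobenii `φ j` at places `v j ∉ S` close to the `g j`
    have hD := absoluteGaloisGroup.frobenius_dense
      Literature.NumberTheory.Automorphic.chebotarev_artinRep_holds ℚ S hS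
    have hexφ : ∀ j : Fin s, ∃ φ : absoluteGaloisGroup ℚ, ‖κ j φ - κ j (g j)‖ < ‖κ j (g j)‖ ∧
        ∃ v ∉ S, ∃ 𝔓 ∈ v.primesAbove, IsArithFrobAt (𝓞 ℚ) φ 𝔓 := by
      intro j
      have hUo : IsOpen {x | ‖κ j x - κ j (g j)‖ < ‖κ j (g j)‖} :=
        isOpen_lt ((hκc j).sub continuous_const).norm continuous_const
      have hgU : g j ∈ {x | ‖κ j x - κ j (g j)‖ < ‖κ j (g j)‖} := by
        simp only [Set.mem_setOf_eq, sub_self, norm_zero]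
        exact hδ j
      obtain ⟨φ, hφU, hφD⟩ := hD.inter_open_nonempty _ hUo ⟨g j, hgU⟩
      exact ⟨φ, hφU, hφD⟩
    choose φ hφU v hvS 𝔓 h𝔓 hφ using hexφ
    have hnκ : ∀ j, ‖κ j (φ j)‖ = ‖κ j (g j)‖ := fun j => norm_eq_of_norm_sub_lt (hφU j)
    -- integral Frobenius polynomials at the `φ j`
    have hexPc : ∀ j, ∃ Pc : Polynomial 𝒪[PadicAlgCl p],
        Pc.map (𝒪[PadicAlgCl p]).subtype = (rc j (φ j)).val.charpoly :=
      fun j => FramedGaloisRep.exists_charpoly_eq_map (rc j) (φ j)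
    choose Pc hPc using hexPc
    have hPrφ : ∀ j, (Pr (v j)).map (𝒪[PadicAlgCl p]).subtype = (ρ (φ j)).val.charpoly :=
      fun j => ((hPr (v j) (hvS j)).2 (𝔓 j) (h𝔓 j) (φ j) (hφ j)).symm
    have hPfφ : ∀ i j, (Pf i (v j)).map (𝒪[PadicAlgCl p]).subtype = (ρf i (φ j)).val.charpoly :=
      fun i j => ((hPf i (v j) (hvS j)).2 (𝔓 j) (h𝔓 j) (φ j) (hφ j)).symm
    -- the test polynomial `F`
    obtain ⟨F, hF⟩ : ∃ F : MvPolynomial (HeightOneSpectrum (𝓞 ℚ) × ℕ) 𝒪[PadicAlgCl p],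
        F = ∏ j, (MvPolynomial.X (v j, d j) - MvPolynomial.C ((Pc j).coeff (d j))) := ⟨_, rfl⟩
    have hsupp : ∀ m ∈ F.support, ∀ x ∈ m.support, x.1 ∉ S := by
      classical
      intro m hm x hx
      have hxv : x ∈ F.vars := (MvPolynomial.mem_vars_iff_mem_support x).2 ⟨m, hm, hx⟩
      rw [hF] at hxv
      obtain ⟨j, -, hj⟩ := Finset.mem_biUnion.1 (MvPolynomial.vars_prod _ hxv)
      have hx' := MvPolynomial.vars_sub_subset _ hj
      rw [MvPolynomial.vars_X, MvPolynomial.vars_C, Finset.union_empty, Finset.mem_singleton] at hx'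
      subst hx'
      exact hvS j
    have hvan : ∀ i, MvPolynomial.eval (fun x => (Pf i x.1).coeff x.2) F = 0 := by
      intro i
      obtain ⟨j₀, hj₀⟩ := hcat (πf i) (ρf i) (hmem i)
      have heq : Pf i (v j₀) = Pc j₀ := by
        refine Polynomial.map_injective _ (Subring.subtype_injective _) ?_
        rw [hPfφ, hPc]
        exact hj₀ (φ j₀)
      rw [hF, map_prod]
      refine Finset.prod_eq_zero (Finset.mem_univ j₀) ?_
      simp only [map_sub, MvPolynomial.eval_X, MvPolynomial.eval_C]
      rw [heq, sub_self]
    have hevρ : MvPolynomial.eval (fun x => (Pr x.1).coeff x.2) F =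
        ∏ j, ((Pr (v j)).coeff (d j) - (Pc j).coeff (d j)) := by
      rw [hF, map_prod]
      simp only [map_sub, MvPolynomial.eval_X, MvPolynomial.eval_C]
    -- `p ^ N ∣ F(ρ) = ∏ j, x j` in `ℤ̄_p`
    have hdvd := hHSC F hsupp hvan
    rw [hevρ] at hdvd
    obtain ⟨t, ht⟩ := hdvd
    have hcoe : ∀ j, (𝒪[PadicAlgCl p]).subtype ((Pr (v j)).coeff (d j) - (Pc j).coeff (d j)) =
        κ j (φ j) := by
      intro j
      rw [map_sub, hκ, ← hPrφ, ← hPc, Polynomial.coeff_map, Polynomial.coeff_map]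
    have h := congrArg (𝒪[PadicAlgCl p]).subtype ht
    rw [map_prod, map_mul, map_pow, map_natCast] at h
    have h' : ∏ j, κ j (φ j) = (p : PadicAlgCl p) ^ N * (𝒪[PadicAlgCl p]).subtype t := by
      rw [← h]
      exact Finset.prod_congr rfl fun j _ => (hcoe j).symm
    -- norms: `∏ j, ‖δ j‖ ≤ ‖p‖ ^ N`, contradiction
    have hle : ∏ j, ‖κ j (g j)‖ ≤ ‖(p : PadicAlgCl p)‖ ^ N := by
      calc ∏ j, ‖κ j (g j)‖ = ∏ j, ‖κ j (φ j)‖ := Finset.prod_congr rfl fun j _ => (hnκ j).symm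
        _ = ‖∏ j, κ j (φ j)‖ := (norm_prod _ _).symm
        _ = ‖(p : PadicAlgCl p)‖ ^ N * ‖(𝒪[PadicAlgCl p]).subtype t‖ := by
          rw [h', norm_mul, norm_pow]
        _ ≤ ‖(p : PadicAlgCl p)‖ ^ N :=
          mul_le_of_le_one_right (pow_nonneg (norm_nonneg _) _) (norm_subtype_le_one t)
    exact absurd hN (not_lt.2 hle)

end Summit.Langlands.Langlands.Cruxes.ResiduallyYoshidaLifting.CrossRegularAnnihilatorPrimes

end
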